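import Literature.NumberTheory.DiophantineGeometry.GLPolynomialRepSemisimpleProofs
import HarnessLib

/-!
# Invariant lifting and invariant splitting for (up to three) commuting completely reducible actions

The two consequences of complete reducibility that invariant theory actually consumes — for a
completely reducible representation `ρ` of `G` on `V` and `G`-stable subspaces `A`, `B`:

* **lifting** (`exists_fixed_sub_mem`): a vector invariant modulo `A` (`ρ g v - v ∈ A` for all `g`)
  is congruent modulo `A` to an invariant vector;
* **splitting** (`exists_fixed_add_eq_of_mem_sup`): an invariant vector of `A + B` is a sum of
  invariant vectors of `A` and of `B`

— i.e. exactness of `V ↦ V^G` / naturality of the Reynolds operator (Mumford–Fogarty–Kirwan, GIT,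
Ch. 1 §1, Def. 1.5 and the discussion following it; for one group the splitting is the tree's
`exists_invariant_add_eq_of_mem_sup`, here with the lifting companion), and their extension to **two and
three pairwise commuting actions** `ρ₁, ρ₂, ρ₃` each completely reducible on `V`
(`exists_fixed₂_sub_mem`, `exists_fixed₂_add_eq_of_mem_sup`, `exists_fixed₃_sub_mem`,
`exists_fixed₃_add_eq_of_mem_sup`): one first lifts/splits for `ρ₁`, then works inside the
`ρ₁`-invariants `V^{ρ₁}` — stable under `ρ₂, ρ₃` by commutation, and the restricted actions are again
completely reducible (`isSemisimpleRepresentation_toRepresentation`) — and iterates. No joint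
(product-group) complete reducibility is needed. Written for the `SL_m × SL_m × SL_m`-invariants of
`O(⊗³ℂ^m)` of Bürgisser–Ikenmeyer 2017 §5 (cell `val-lit`, route note
`HOME/bip/NOTE-t09g4-TensorReynolds-route.md`), where the three slot actions are completely reducible
(`Literature/Computability/AlgebraicComplexity/TensorCoordSubst.lean`).

Honest framing: elementary linear algebra of complemented lattices of subrepresentations; nothing
here is progress on VP ≠ VNP.

## References

* [MumfordFogartyKirwan1994] D. Mumford, J. Fogarty, F. Kirwan, *Geometric Invariant Theory*, 3rd ed.,
  Springer 1994, Ch. 1 §1 (Def. 1.5, the Reynolds operator, and the remarks after it).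

## Mathlib

`Representation.IsSemisimpleRepresentation` (= `ComplementedLattice (Subrepresentation ρ)`),
`Subrepresentation.toRepresentation`, `Representation.invariants`; tree:
`isSemisimpleRepresentation_toRepresentation` (`GLPolynomialRepSemisimpleProofs`).
-/

noncomputable section

namespace Literature.RepresentationTheory.Semisimple

open Literature.NumberTheory.DiophantineGeometry (isSemisimpleRepresentation_toRepresentation)

variable {k V : Type*} [Field k] [AddCommGroup V] [Module k V]

section One

variable {G : Type*} [Monoid G] {ρ : Representation k G V}

/-- The restricted action on a subrepresentation, read in the ambient space. [folklore] -/
private theorem toRepresentation_apply_coe (U : Subrepresentation ρ) (g : G) (x : U.toSubmodule) :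
    ((U.toRepresentation g x : U.toSubmodule) : V) = ρ g x := rfl

/-- **Invariant lifting**: in a completely reducible representation, a vector invariant modulo a
stable subspace `A` (`ρ g v - v ∈ A` for all `g`) is congruent modulo `A` to an invariant vector
(project along a stable complement of `A`). Surjectivity of `V^G → (V/A)^G`, i.e. exactness of the
Reynolds operator. [cite: MumfordFogartyKirwan1994, Ch. 1 §1 Def. 1.5] -/
theorem exists_fixed_sub_mem (hρ : ρ.IsSemisimpleRepresentation) (A : Subrepresentation ρ) {v : V}
    (hv : ∀ g : G, ρ g v - v ∈ A.toSubmodule) :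
    ∃ u : V, (∀ g : G, ρ g u = u) ∧ v - u ∈ A.toSubmodule := by
  obtain ⟨C, hC⟩ := hρ.exists_isCompl A
  have hbot : A.toSubmodule ⊓ C.toSubmodule = (⊥ : Subrepresentation ρ).toSubmodule := by
    have := congrArg Subrepresentation.toSubmodule (disjoint_iff.1 hC.disjoint)
    rwa [Subrepresentation.toSubmodule_inf] at this
  have htop : A.toSubmodule ⊔ C.toSubmodule = (⊤ : Subrepresentation ρ).toSubmodule := by
    have := congrArg Subrepresentation.toSubmodule (codisjoint_iff.1 hC.codisjoint)
    rwa [Subrepresentation.toSubmodule_sup] at this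
  have hvtop : v ∈ A.toSubmodule ⊔ C.toSubmodule := by
    rw [htop]
    exact Submodule.mem_top
  obtain ⟨a, ha, c, hc, rfl⟩ := Submodule.mem_sup.1 hvtop
  refine ⟨c, fun g => ?_, by rw [add_sub_cancel_right]; exact ha⟩
  have h1 : ρ g c - c ∈ C.toSubmodule := C.toSubmodule.sub_mem (C.apply_mem_toSubmodule g hc) hc
  have h2 : ρ g c - c ∈ A.toSubmodule := by
    have e : ρ g c - c = (ρ g (a + c) - (a + c)) - (ρ g a - a) := by
      rw [map_add]; abel
    rw [e]
    exact A.toSubmodule.sub_mem (hv g) (A.toSubmodule.sub_mem (A.apply_mem_toSubmodule g ha) ha)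
  have h3 : ρ g c - c ∈ A.toSubmodule ⊓ C.toSubmodule := Submodule.mem_inf.2 ⟨h2, h1⟩
  rw [hbot] at h3
  exact sub_eq_zero.1 ((Submodule.mem_bot k).1 h3)

/-- **Invariant splitting**: in a completely reducible representation, an invariant vector of
`A + B` (`A`, `B` stable) is `a + b` with `a ∈ A`, `b ∈ B` both invariant (the tree's
`exists_invariant_add_eq_of_mem_sup`, valid for monoids: take a stable complement `C` of `A ∩ B`; then
`A + B = A ⊕ (B ∩ C)` and the components are invariant by uniqueness).
[cite: MumfordFogartyKirwan1994, Ch. 1 §1 Def. 1.5] -/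
theorem exists_fixed_add_eq_of_mem_sup (hρ : ρ.IsSemisimpleRepresentation)
    (A B : Subrepresentation ρ) {v : V} (hv : v ∈ A.toSubmodule ⊔ B.toSubmodule)
    (hinv : ∀ g : G, ρ g v = v) :
    ∃ a ∈ A.toSubmodule, ∃ b ∈ B.toSubmodule,
      (∀ g : G, ρ g a = a) ∧ (∀ g : G, ρ g b = b) ∧ a + b = v := by
  obtain ⟨C, hC⟩ := hρ.exists_isCompl (A ⊓ B)
  have hbot : A.toSubmodule ⊓ B.toSubmodule ⊓ C.toSubmodule = (⊥ : Subrepresentation ρ).toSubmodule := by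
    have := congrArg Subrepresentation.toSubmodule (disjoint_iff.1 hC.disjoint)
    rwa [Subrepresentation.toSubmodule_inf, Subrepresentation.toSubmodule_inf] at this
  have htop : A.toSubmodule ⊓ B.toSubmodule ⊔ C.toSubmodule = ⊤ := by
    have := congrArg Subrepresentation.toSubmodule (codisjoint_iff.1 hC.codisjoint)
    rw [Subrepresentation.toSubmodule_sup, Subrepresentation.toSubmodule_inf] at this
    exact this
  have hB : A.toSubmodule ⊓ B.toSubmodule ⊔ C.toSubmodule ⊓ B.toSubmodule = B.toSubmodule := by
    rw [← sup_inf_assoc_of_le C.toSubmodule (inf_le_right : A.toSubmodule ⊓ B.toSubmodule ≤ _),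
      htop, top_inf_eq]
  have hsup : A.toSubmodule ⊔ C.toSubmodule ⊓ B.toSubmodule = A.toSubmodule ⊔ B.toSubmodule := by
    apply le_antisymm
    · exact sup_le le_sup_left (inf_le_right.trans le_sup_right)
    · conv_lhs => rw [← hB]
      exact sup_le le_sup_left (sup_le (inf_le_left.trans le_sup_left) le_sup_right)
  rw [← hsup] at hv
  obtain ⟨a, ha, b, hb, rfl⟩ := Submodule.mem_sup.1 hv
  have hbC : b ∈ C.toSubmodule := (Submodule.mem_inf.1 hb).1
  have hbB : b ∈ B.toSubmodule := (Submodule.mem_inf.1 hb).2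
  have ha' : ∀ g : G, ρ g a = a := by
    intro g
    have h1 : ρ g a - a ∈ A.toSubmodule := A.toSubmodule.sub_mem (A.apply_mem_toSubmodule g ha) ha
    have h2 : ρ g a - a ∈ C.toSubmodule ⊓ B.toSubmodule := by
      have e : ρ g a - a = b - ρ g b := by
        rw [sub_eq_sub_iff_add_eq_add, add_comm b a]
        have := hinv g
        rwa [map_add] at this
      rw [e]
      exact Submodule.sub_mem _ hb
        (Submodule.mem_inf.2 ⟨C.apply_mem_toSubmodule g hbC, B.apply_mem_toSubmodule g hbB⟩)
    have h3 : ρ g a - a ∈ A.toSubmodule ⊓ B.toSubmodule ⊓ C.toSubmodule :=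
      Submodule.mem_inf.2 ⟨Submodule.mem_inf.2 ⟨h1, (Submodule.mem_inf.1 h2).2⟩,
        (Submodule.mem_inf.1 h2).1⟩
    rw [hbot] at h3
    exact sub_eq_zero.1 ((Submodule.mem_bot k).1 h3)
  refine ⟨a, ha, b, hbB, ha', fun g => ?_, rfl⟩
  have := hinv g
  rw [map_add, ha' g] at this
  exact add_left_cancel this

/-- **Invariant lifting, stated with `Representation.invariants`** (for a group): a vector invariant
modulo the stable subspace `A` is congruent modulo `A` to an element of `V^G = ρ.invariants`.
[cite: MumfordFogartyKirwan1994, Ch. 1 §1 Def. 1.5] -/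
theorem exists_mem_invariants_sub_mem {G : Type*} [Group G] {ρ : Representation k G V}
    (hρ : ρ.IsSemisimpleRepresentation) (A : Subrepresentation ρ) {v : V}
    (hv : ∀ g : G, ρ g v - v ∈ A.toSubmodule) :
    ∃ u ∈ ρ.invariants, v - u ∈ A.toSubmodule := by
  obtain ⟨u, hu, hvu⟩ := exists_fixed_sub_mem hρ A hv
  exact ⟨u, (ρ.mem_invariants u).2 hu, hvu⟩

end One

/-! ### Two commuting actions -/

section Two

variable {G₁ G₂ : Type*} [Group G₁] [Group G₂]
  {ρ₁ : Representation k G₁ V} {ρ₂ : Representation k G₂ V}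

/-- **Invariant lifting for two commuting completely reducible actions**: if `v` is invariant modulo
the jointly stable subspace `A` under both `ρ₁` and `ρ₂`, then `v ≡ u (mod A)` for some `u` fixed by
both (lift for `ρ₁`, then lift inside `V^{ρ₁}` for `ρ₂`).
[cite: MumfordFogartyKirwan1994, Ch. 1 §1 Def. 1.5] -/
theorem exists_fixed₂_sub_mem (h₁ : ρ₁.IsSemisimpleRepresentation)
    (h₂ : ρ₂.IsSemisimpleRepresentation)
    (hcomm : ∀ (g : G₁) (h : G₂) (v : V), ρ₁ g (ρ₂ h v) = ρ₂ h (ρ₁ g v))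
    (A : Submodule k V) (hA₁ : ∀ (g : G₁), ∀ v ∈ A, ρ₁ g v ∈ A)
    (hA₂ : ∀ (h : G₂), ∀ v ∈ A, ρ₂ h v ∈ A) {v : V}
    (hv₁ : ∀ g : G₁, ρ₁ g v - v ∈ A) (hv₂ : ∀ h : G₂, ρ₂ h v - v ∈ A) :
    ∃ u : V, (∀ g : G₁, ρ₁ g u = u) ∧ (∀ h : G₂, ρ₂ h u = u) ∧ v - u ∈ A := by
  -- step 1: lift for `ρ₁`
  obtain ⟨u₁, hu₁, hvu₁⟩ := exists_fixed_sub_mem h₁ ⟨A, hA₁⟩ hv₁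
  have hu₁₂ : ∀ h : G₂, ρ₂ h u₁ - u₁ ∈ A := fun h => by
    have e : ρ₂ h u₁ - u₁ = (ρ₂ h v - v) - (ρ₂ h (v - u₁) - (v - u₁)) := by
      rw [map_sub]; abel
    rw [e]
    exact A.sub_mem (hv₂ h) (A.sub_mem (hA₂ h _ hvu₁) hvu₁)
  -- step 2: lift for `ρ₂` inside `U = V^{ρ₁}`
  let U : Subrepresentation ρ₂ :=
    { toSubmodule := ρ₁.invariants
      apply_mem_toSubmodule := fun h x hx => by
        rw [Representation.mem_invariants] at hx ⊢
        intro g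
        rw [hcomm, hx g] }
  have hU : U.toRepresentation.IsSemisimpleRepresentation :=
    isSemisimpleRepresentation_toRepresentation U h₂
  let A' : Subrepresentation U.toRepresentation :=
    { toSubmodule := A.comap U.toSubmodule.subtype
      apply_mem_toSubmodule := fun g x hx => by
        simp only [Submodule.mem_comap, Submodule.subtype_apply] at hx ⊢
        exact hA₂ g _ hx }
  have hmemU : u₁ ∈ U.toSubmodule := (ρ₁.mem_invariants u₁).2 hu₁
  obtain ⟨u', hu', hvu'⟩ := exists_fixed_sub_mem hU A' (v := ⟨u₁, hmemU⟩)
    (fun h => by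
      change ((U.toRepresentation h ⟨u₁, hmemU⟩ - ⟨u₁, hmemU⟩ : U.toSubmodule) : V) ∈ A
      rw [Submodule.coe_sub, toRepresentation_apply_coe]
      exact hu₁₂ h)
  refine ⟨(u' : V), fun g => (ρ₁.mem_invariants _).1 u'.2 g, fun h => ?_, ?_⟩
  · have := congrArg Subtype.val (hu' h)
    rwa [toRepresentation_apply_coe] at this
  · have h' : u₁ - (u' : V) ∈ A := by
      change (((⟨u₁, hmemU⟩ : U.toSubmodule) - u' : U.toSubmodule) : V) ∈ A at hvu'
      rwa [Submodule.coe_sub] at hvu'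
    have e : v - (u' : V) = (v - u₁) + (u₁ - u') := by abel
    rw [e]
    exact A.add_mem hvu₁ h'

/-- **Invariant splitting for two commuting completely reducible actions**: a vector of `A + B`
(`A`, `B` jointly stable) fixed by `ρ₁` and `ρ₂` is `a + b` with `a ∈ A`, `b ∈ B` both fixed by
`ρ₁` and `ρ₂`. [cite: MumfordFogartyKirwan1994, Ch. 1 §1 Def. 1.5] -/
theorem exists_fixed₂_add_eq_of_mem_sup (h₁ : ρ₁.IsSemisimpleRepresentation)
    (h₂ : ρ₂.IsSemisimpleRepresentation)
    (hcomm : ∀ (g : G₁) (h : G₂) (v : V), ρ₁ g (ρ₂ h v) = ρ₂ h (ρ₁ g v))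
    (A B : Submodule k V) (hA₁ : ∀ (g : G₁), ∀ v ∈ A, ρ₁ g v ∈ A)
    (hA₂ : ∀ (h : G₂), ∀ v ∈ A, ρ₂ h v ∈ A) (hB₁ : ∀ (g : G₁), ∀ v ∈ B, ρ₁ g v ∈ B)
    (hB₂ : ∀ (h : G₂), ∀ v ∈ B, ρ₂ h v ∈ B) {v : V} (hv : v ∈ A ⊔ B)
    (hv₁ : ∀ g : G₁, ρ₁ g v = v) (hv₂ : ∀ h : G₂, ρ₂ h v = v) :
    ∃ a ∈ A, ∃ b ∈ B, (∀ g : G₁, ρ₁ g a = a) ∧ (∀ h : G₂, ρ₂ h a = a) ∧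
      (∀ g : G₁, ρ₁ g b = b) ∧ (∀ h : G₂, ρ₂ h b = b) ∧ a + b = v := by
  -- step 1: split for `ρ₁`
  obtain ⟨a₁, ha₁, b₁, hb₁, ha₁i, hb₁i, hab₁⟩ :=
    exists_fixed_add_eq_of_mem_sup h₁ ⟨A, hA₁⟩ ⟨B, hB₁⟩ hv hv₁
  -- step 2: split for `ρ₂` inside `U = V^{ρ₁}`
  let U : Subrepresentation ρ₂ :=
    { toSubmodule := ρ₁.invariants
      apply_mem_toSubmodule := fun h x hx => by
        rw [Representation.mem_invariants] at hx ⊢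
        intro g
        rw [hcomm, hx g] }
  have hU : U.toRepresentation.IsSemisimpleRepresentation :=
    isSemisimpleRepresentation_toRepresentation U h₂
  let A' : Subrepresentation U.toRepresentation :=
    { toSubmodule := A.comap U.toSubmodule.subtype
      apply_mem_toSubmodule := fun g x hx => by
        simp only [Submodule.mem_comap, Submodule.subtype_apply] at hx ⊢
        exact hA₂ g _ hx }
  let B' : Subrepresentation U.toRepresentation :=
    { toSubmodule := B.comap U.toSubmodule.subtype
      apply_mem_toSubmodule := fun g x hx => by
        simp only [Submodule.mem_comap, Submodule.subtype_apply] at hx ⊢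
        exact hB₂ g _ hx }
  have hmemU : v ∈ U.toSubmodule := (ρ₁.mem_invariants v).2 hv₁
  have hmem' : (⟨v, hmemU⟩ : U.toSubmodule) ∈ A'.toSubmodule ⊔ B'.toSubmodule := by
    rw [Submodule.mem_sup]
    refine ⟨⟨a₁, (ρ₁.mem_invariants a₁).2 ha₁i⟩, ?_, ⟨b₁, (ρ₁.mem_invariants b₁).2 hb₁i⟩, ?_,
      Subtype.ext hab₁⟩
    · change a₁ ∈ A
      exact ha₁
    · change b₁ ∈ B
      exact hb₁
  obtain ⟨a, ha, b, hb, hai, hbi, hab⟩ := exists_fixed_add_eq_of_mem_sup hU A' B' hmem'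
    (fun h => Subtype.ext (by
      rw [toRepresentation_apply_coe]; exact hv₂ h))
  refine ⟨(a : V), ha, (b : V), hb, fun g => (ρ₁.mem_invariants _).1 a.2 g, fun h => ?_,
    fun g => (ρ₁.mem_invariants _).1 b.2 g, fun h => ?_, ?_⟩
  · have := congrArg Subtype.val (hai h)
    rwa [toRepresentation_apply_coe] at this
  · have := congrArg Subtype.val (hbi h)
    rwa [toRepresentation_apply_coe] at this
  · have := congrArg Subtype.val hab
    rwa [Submodule.coe_add] at this

end Two

/-! ### Three pairwise commuting actions -/

section Three

variable {G₁ G₂ G₃ : Type*} [Group G₁] [Group G₂] [Group G₃]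
  {ρ₁ : Representation k G₁ V} {ρ₂ : Representation k G₂ V} {ρ₃ : Representation k G₃ V}

/-- **Invariant lifting for three pairwise commuting completely reducible actions** (the case of
`SL_m × SL_m × SL_m` on `O(⊗³ℂ^m)`): `v` invariant modulo the jointly stable `A` under `ρ₁, ρ₂, ρ₃`
is congruent modulo `A` to a vector fixed by all three.
[cite: MumfordFogartyKirwan1994, Ch. 1 §1 Def. 1.5] -/
theorem exists_fixed₃_sub_mem (h₁ : ρ₁.IsSemisimpleRepresentation)
    (h₂ : ρ₂.IsSemisimpleRepresentation) (h₃ : ρ₃.IsSemisimpleRepresentation)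
    (hc₁₂ : ∀ (g : G₁) (h : G₂) (v : V), ρ₁ g (ρ₂ h v) = ρ₂ h (ρ₁ g v))
    (hc₁₃ : ∀ (g : G₁) (h : G₃) (v : V), ρ₁ g (ρ₃ h v) = ρ₃ h (ρ₁ g v))
    (hc₂₃ : ∀ (g : G₂) (h : G₃) (v : V), ρ₂ g (ρ₃ h v) = ρ₃ h (ρ₂ g v))
    (A : Submodule k V) (hA₁ : ∀ (g : G₁), ∀ v ∈ A, ρ₁ g v ∈ A)
    (hA₂ : ∀ (h : G₂), ∀ v ∈ A, ρ₂ h v ∈ A) (hA₃ : ∀ (h : G₃), ∀ v ∈ A, ρ₃ h v ∈ A) {v : V}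
    (hv₁ : ∀ g : G₁, ρ₁ g v - v ∈ A) (hv₂ : ∀ h : G₂, ρ₂ h v - v ∈ A)
    (hv₃ : ∀ h : G₃, ρ₃ h v - v ∈ A) :
    ∃ u : V, (∀ g : G₁, ρ₁ g u = u) ∧ (∀ h : G₂, ρ₂ h u = u) ∧ (∀ h : G₃, ρ₃ h u = u) ∧
      v - u ∈ A := by
  -- step 1: lift for `ρ₁`
  obtain ⟨u₁, hu₁, hvu₁⟩ := exists_fixed_sub_mem h₁ ⟨A, hA₁⟩ hv₁
  have hu₁₂ : ∀ h : G₂, ρ₂ h u₁ - u₁ ∈ A := fun h => by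
    have e : ρ₂ h u₁ - u₁ = (ρ₂ h v - v) - (ρ₂ h (v - u₁) - (v - u₁)) := by
      rw [map_sub]; abel
    rw [e]
    exact A.sub_mem (hv₂ h) (A.sub_mem (hA₂ h _ hvu₁) hvu₁)
  have hu₁₃ : ∀ h : G₃, ρ₃ h u₁ - u₁ ∈ A := fun h => by
    have e : ρ₃ h u₁ - u₁ = (ρ₃ h v - v) - (ρ₃ h (v - u₁) - (v - u₁)) := by
      rw [map_sub]; abel
    rw [e]
    exact A.sub_mem (hv₃ h) (A.sub_mem (hA₃ h _ hvu₁) hvu₁)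
  -- steps 2–3: two commuting actions `ρ₂, ρ₃` inside `U = V^{ρ₁}`
  let U₂ : Subrepresentation ρ₂ :=
    { toSubmodule := ρ₁.invariants
      apply_mem_toSubmodule := fun h x hx => by
        rw [Representation.mem_invariants] at hx ⊢
        intro g
        rw [hc₁₂, hx g] }
  let U₃ : Subrepresentation ρ₃ :=
    { toSubmodule := ρ₁.invariants
      apply_mem_toSubmodule := fun h x hx => by
        rw [Representation.mem_invariants] at hx ⊢
        intro g
        rw [hc₁₃, hx g] }
  have hU₂ : U₂.toRepresentation.IsSemisimpleRepresentation :=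
    isSemisimpleRepresentation_toRepresentation U₂ h₂
  have hU₃ : U₃.toRepresentation.IsSemisimpleRepresentation :=
    isSemisimpleRepresentation_toRepresentation U₃ h₃
  have hmemU : u₁ ∈ U₂.toSubmodule := (ρ₁.mem_invariants u₁).2 hu₁
  obtain ⟨u', hu'₂, hu'₃, hvu'⟩ := exists_fixed₂_sub_mem
    (ρ₁ := U₂.toRepresentation) (ρ₂ := U₃.toRepresentation) hU₂ hU₃
    (fun g h x => Subtype.ext (by
      rw [toRepresentation_apply_coe, toRepresentation_apply_coe, toRepresentation_apply_coe,
        toRepresentation_apply_coe]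
      exact hc₂₃ g h x))
    (A.comap U₂.toSubmodule.subtype)
    (fun g x hx => by
      simp only [Submodule.mem_comap, Submodule.subtype_apply, toRepresentation_apply_coe] at hx ⊢
      exact hA₂ g _ hx)
    (fun h x hx => by
      simp only [Submodule.mem_comap, Submodule.subtype_apply, toRepresentation_apply_coe] at hx ⊢
      exact hA₃ h _ hx)
    (v := ⟨u₁, hmemU⟩)
    (fun h => by
      simp only [Submodule.mem_comap, Submodule.subtype_apply, Submodule.coe_sub,
        toRepresentation_apply_coe]
      exact hu₁₂ h)
    (fun h => by
      simp only [Submodule.mem_comap, Submodule.subtype_apply, Submodule.coe_sub,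
        toRepresentation_apply_coe]
      exact hu₁₃ h)
  refine ⟨(u' : V), fun g => (ρ₁.mem_invariants _).1 u'.2 g, fun h => ?_, fun h => ?_, ?_⟩
  · have := congrArg Subtype.val (hu'₂ h)
    rwa [toRepresentation_apply_coe] at this
  · have := congrArg Subtype.val (hu'₃ h)
    rwa [toRepresentation_apply_coe] at this
  · have h' : u₁ - (u' : V) ∈ A := by
      simp only [Submodule.mem_comap, Submodule.subtype_apply, Submodule.coe_sub] at hvu'
      exact hvu'
    have e : v - (u' : V) = (v - u₁) + (u₁ - u') := by abel
    rw [e]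
    exact A.add_mem hvu₁ h'

/-- **Invariant splitting for three pairwise commuting completely reducible actions**: a vector of
`A + B` (`A`, `B` jointly stable) fixed by `ρ₁, ρ₂, ρ₃` is `a + b` with `a ∈ A`, `b ∈ B` both fixed
by all three. [cite: MumfordFogartyKirwan1994, Ch. 1 §1 Def. 1.5] -/
theorem exists_fixed₃_add_eq_of_mem_sup (h₁ : ρ₁.IsSemisimpleRepresentation)
    (h₂ : ρ₂.IsSemisimpleRepresentation) (h₃ : ρ₃.IsSemisimpleRepresentation)
    (hc₁₂ : ∀ (g : G₁) (h : G₂) (v : V), ρ₁ g (ρ₂ h v) = ρ₂ h (ρ₁ g v))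
    (hc₁₃ : ∀ (g : G₁) (h : G₃) (v : V), ρ₁ g (ρ₃ h v) = ρ₃ h (ρ₁ g v))
    (hc₂₃ : ∀ (g : G₂) (h : G₃) (v : V), ρ₂ g (ρ₃ h v) = ρ₃ h (ρ₂ g v))
    (A B : Submodule k V) (hA₁ : ∀ (g : G₁), ∀ v ∈ A, ρ₁ g v ∈ A)
    (hA₂ : ∀ (h : G₂), ∀ v ∈ A, ρ₂ h v ∈ A) (hA₃ : ∀ (h : G₃), ∀ v ∈ A, ρ₃ h v ∈ A)
    (hB₁ : ∀ (g : G₁), ∀ v ∈ B, ρ₁ g v ∈ B) (hB₂ : ∀ (h : G₂), ∀ v ∈ B, ρ₂ h v ∈ B)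
    (hB₃ : ∀ (h : G₃), ∀ v ∈ B, ρ₃ h v ∈ B) {v : V} (hv : v ∈ A ⊔ B)
    (hv₁ : ∀ g : G₁, ρ₁ g v = v) (hv₂ : ∀ h : G₂, ρ₂ h v = v) (hv₃ : ∀ h : G₃, ρ₃ h v = v) :
    ∃ a ∈ A, ∃ b ∈ B,
      ((∀ g : G₁, ρ₁ g a = a) ∧ (∀ h : G₂, ρ₂ h a = a) ∧ (∀ h : G₃, ρ₃ h a = a)) ∧
      ((∀ g : G₁, ρ₁ g b = b) ∧ (∀ h : G₂, ρ₂ h b = b) ∧ (∀ h : G₃, ρ₃ h b = b)) ∧ a + b = v := by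
  -- step 1: split for `ρ₁`
  obtain ⟨a₁, ha₁, b₁, hb₁, ha₁i, hb₁i, hab₁⟩ :=
    exists_fixed_add_eq_of_mem_sup h₁ ⟨A, hA₁⟩ ⟨B, hB₁⟩ hv hv₁
  -- steps 2–3 inside `U = V^{ρ₁}`
  let U₂ : Subrepresentation ρ₂ :=
    { toSubmodule := ρ₁.invariants
      apply_mem_toSubmodule := fun h x hx => by
        rw [Representation.mem_invariants] at hx ⊢
        intro g
        rw [hc₁₂, hx g] }
  let U₃ : Subrepresentation ρ₃ :=
    { toSubmodule := ρ₁.invariants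
      apply_mem_toSubmodule := fun h x hx => by
        rw [Representation.mem_invariants] at hx ⊢
        intro g
        rw [hc₁₃, hx g] }
  have hU₂ : U₂.toRepresentation.IsSemisimpleRepresentation :=
    isSemisimpleRepresentation_toRepresentation U₂ h₂
  have hU₃ : U₃.toRepresentation.IsSemisimpleRepresentation :=
    isSemisimpleRepresentation_toRepresentation U₃ h₃
  have hmemU : v ∈ U₂.toSubmodule := (ρ₁.mem_invariants v).2 hv₁
  have hmem' : (⟨v, hmemU⟩ : U₂.toSubmodule) ∈
      A.comap U₂.toSubmodule.subtype ⊔ B.comap U₂.toSubmodule.subtype := by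
    rw [Submodule.mem_sup]
    refine ⟨⟨a₁, (ρ₁.mem_invariants a₁).2 ha₁i⟩, ?_, ⟨b₁, (ρ₁.mem_invariants b₁).2 hb₁i⟩, ?_,
      Subtype.ext hab₁⟩
    · change a₁ ∈ A
      exact ha₁
    · change b₁ ∈ B
      exact hb₁
  obtain ⟨a, ha, b, hb, ha₂, ha₃, hb₂, hb₃, hab⟩ :=
    exists_fixed₂_add_eq_of_mem_sup
      (ρ₁ := U₂.toRepresentation) (ρ₂ := U₃.toRepresentation) hU₂ hU₃
      (fun g h x => Subtype.ext (by
        rw [toRepresentation_apply_coe, toRepresentation_apply_coe, toRepresentation_apply_coe,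
          toRepresentation_apply_coe]
        exact hc₂₃ g h x))
      (A.comap U₂.toSubmodule.subtype) (B.comap U₂.toSubmodule.subtype)
      (fun g x hx => by
        simp only [Submodule.mem_comap, Submodule.subtype_apply, toRepresentation_apply_coe] at hx ⊢
        exact hA₂ g _ hx)
      (fun h x hx => by
        simp only [Submodule.mem_comap, Submodule.subtype_apply, toRepresentation_apply_coe] at hx ⊢
        exact hA₃ h _ hx)
      (fun g x hx => by
        simp only [Submodule.mem_comap, Submodule.subtype_apply, toRepresentation_apply_coe] at hx ⊢
        exact hB₂ g _ hx)
      (fun h x hx => by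
        simp only [Submodule.mem_comap, Submodule.subtype_apply, toRepresentation_apply_coe] at hx ⊢
        exact hB₃ h _ hx)
      hmem'
      (fun h => Subtype.ext (by rw [toRepresentation_apply_coe]; exact hv₂ h))
      (fun h => Subtype.ext (by rw [toRepresentation_apply_coe]; exact hv₃ h))
  refine ⟨(a : V), ha, (b : V), hb,
    ⟨fun g => (ρ₁.mem_invariants _).1 a.2 g, fun h => ?_, fun h => ?_⟩,
    ⟨fun g => (ρ₁.mem_invariants _).1 b.2 g, fun h => ?_, fun h => ?_⟩, ?_⟩
  · have := congrArg Subtype.val (ha₂ h)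
    rwa [toRepresentation_apply_coe] at this
  · have := congrArg Subtype.val (ha₃ h)
    rwa [toRepresentation_apply_coe] at this
  · have := congrArg Subtype.val (hb₂ h)
    rwa [toRepresentation_apply_coe] at this
  · have := congrArg Subtype.val (hb₃ h)
    rwa [toRepresentation_apply_coe] at this
  · have := congrArg Subtype.val hab
    rwa [Submodule.coe_add] at this

end Three

end Literature.RepresentationTheory.Semisimple

end
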